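import Literature.LinearAlgebra.Matrix.CharpolyLocalRigidity
import Mathlib.LinearAlgebra.Charpoly.ToMatrix
import Mathlib.LinearAlgebra.Eigenspace.Minpoly
import Mathlib.FieldTheory.IsAlgClosed.AlgebraicClosure
import HarnessLib

/-!
# The regular semisimple locus is open: matrices with separable characteristic polynomial form an open set

Topic `LinearAlgebra/Matrix`; namespace `Literature.LinearAlgebra.Matrix`. THEOREMS ONLY over Mathlib + ★ `CharpolyLocalRigidity` + ★
`CentraliserOfSeparableCharpoly` (no definition, no instance, no notation, no named fact, no `sorry`). Cell `pub/hodgecm-mathlib`, road «N6-ns»,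
brick N6ns-reg-(ii) FILE 3 rider (LEAD T8-2 (3) ∕ T8-15 (B)): the torus box of a regular orbit chart may be taken inside the regular locus
`T_reg`, because that locus is OPEN.

THE MATHEMATICS. (§1, algebra) If `χ_x′(x)` is a UNIT then `χ_x` is SEPARABLE: otherwise `χ_x` and `χ_x′` have a common root `a` in an
algebraic closure `K̄` (Mathlib `Polynomial.isCoprime_iff_aeval_ne_zero_of_isAlgClosed`); `a` is an eigenvalue of `x ⊗ K̄` with an eigenvector `v`
(★ `exists_hasEigenvector_of_mem_roots`), and `χ_x′(x ⊗ K̄) v = χ_x′(a) v = 0` (Mathlib `Module.End.aeval_apply_of_hasEigenvector`) contradicts the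
invertibility of `χ_x′(x) ⊗ K̄`. Together with ★ `isUnit_aeval_derivative_of_separable` this is the criterion «`χ_x` separable ⇔ `χ_x′(x)` invertible».
(§2, topology) `x ↦ χ_x′(x) = D(χ_x; x, x)` is continuous (★ `dividedDiff_self`, ★ `continuous_charpoly_coeff`) and the units of `M_n(E)` are the
open locus `det ≠ 0`; hence `{x | χ_x separable}` is open (`isOpen_setOf_charpoly_separable`), and so are its traces on `GL_n(E)` and on any
subgroup `U ≤ GL_n(E)` (`isOpen_setOf_charpoly_separable_units`, `Subgroup.isOpen_setOf_charpoly_separable`).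

## References
* [Borel1991] A. Borel, *Linear Algebraic Groups*, 2nd ed. (1991), IV.12.2–12.3 (regular semisimple elements form a non-empty open set).
* [HarishChandra1970] Harish-Chandra (notes by G. van Dijk), *Harmonic Analysis on Reductive p-adic Groups*, LNM 162 (1970), Part I §3 (`G′` open).
* [Rogawski1990] J. D. Rogawski, *Automorphic Representations of Unitary Groups in Three Variables*, Ann. of Math. Stud. 123 (1990), §3.1 p. 19.
-/

set_option autoImplicit false

open Polynomial Filter Topology
open scoped Matrix MatrixGroups

namespace Literature.LinearAlgebra.Matrix

/-! ## §1 `χ_x′(x)` invertible ⇒ `χ_x` separable -/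

section Algebra

variable {E : Type*} [Field E] {n : Type*} [Fintype n] [DecidableEq n]

/-- Base change of `p(x)` along a ring map `φ`: `(p(x)).map φ = (p.map φ)(x.map φ)` for a matrix `x`. [cite: Borel1991, IV.12.2] -/
theorem map_aeval_eq_aeval_map_mapMatrix {K : Type*} [Field K] (φ : E →+* K) (p : E[X]) (x : Matrix n n E) :
    (aeval x p).map φ = aeval (x.map φ) (p.map φ) := by
  have h : (algebraMap K (Matrix n n K)).comp φ = (φ.mapMatrix : Matrix n n E →+* Matrix n n K).comp (algebraMap E (Matrix n n E)) := by
    ext r i j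
    simp only [RingHom.comp_apply, Matrix.algebraMap_matrix_apply, RingHom.mapMatrix_apply, Matrix.map_apply]
    split_ifs <;> simp
  exact (map_aeval_eq_aeval_map h p x : _)

/-- **If `χ_x′(x)` is invertible then `χ_x` is separable** (a common root `a ∈ K̄` of `χ_x`, `χ_x′` is an eigenvalue of `x ⊗ K̄` with eigenvector `v`,
and `χ_x′(x ⊗ K̄) v = χ_x′(a) v = 0`). [cite: Borel1991, IV.12.3] [cite: Rogawski1990, §3.1 p. 19] -/
theorem charpoly_separable_of_isUnit_aeval_derivative (x : Matrix n n E) (h : IsUnit (aeval x (derivative x.charpoly))) :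
    x.charpoly.Separable := by
  classical
  by_contra hns
  let K := AlgebraicClosure E
  let φ : E →+* K := algebraMap E K
  -- a common root `a ∈ K̄` of `χ_x` and `χ_x′`
  have hnc : ¬ ∀ a : K, aeval a x.charpoly ≠ 0 ∨ aeval a (derivative x.charpoly) ≠ 0 := fun hall =>
    hns ((Polynomial.isCoprime_iff_aeval_ne_zero_of_isAlgClosed (k := E) (K := K) x.charpoly (derivative x.charpoly)).2 hall)
  simp only [not_forall, not_or, not_not] at hnc
  obtain ⟨a, ha, ha'⟩ := hnc
  -- `a` is an eigenvalue of `x ⊗ K̄`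
  set xK : Matrix n n K := x.map φ with hxK
  have hchar : xK.charpoly = x.charpoly.map φ := by rw [hxK, Matrix.charpoly_map]
  set f : Module.End K (n → K) := Matrix.toLin' xK with hf
  have hfchar : f.charpoly = x.charpoly.map φ := by rw [hf, Matrix.charpoly_toLin', hchar]
  have hroot : a ∈ f.charpoly.roots := by
    rw [Polynomial.mem_roots (f.charpoly_monic.ne_zero), hfchar, IsRoot.def, eval_map_algebraMap]
    exact ha
  obtain ⟨v, hv⟩ := exists_hasEigenvector_of_mem_roots f hroot
  -- `χ_x′(f) v = χ_x′(a) • v = 0`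
  have hzero : aeval f ((derivative x.charpoly).map φ) v = 0 := by
    rw [Module.End.aeval_apply_of_hasEigenvector hv, eval_map_algebraMap, ha', zero_smul]
  -- but `χ_x′(f)` is a unit
  have hunitK : IsUnit (aeval xK ((derivative x.charpoly).map φ)) := by
    rw [hxK, ← map_aeval_eq_aeval_map_mapMatrix φ]
    exact h.map (φ.mapMatrix : Matrix n n E →+* Matrix n n K)
  have hunitf : IsUnit (aeval f ((derivative x.charpoly).map φ)) := by
    rw [hf, show Matrix.toLin' xK = Matrix.toLinAlgEquiv' xK from rfl, aeval_algHom_apply]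
    exact hunitK.map _
  obtain ⟨u, hu⟩ := hunitf
  have hinj : Function.Injective (aeval f ((derivative x.charpoly).map φ)) := by
    rw [← hu]
    exact (Module.End.isUnit_iff _).1 u.isUnit |>.1
  exact hv.2 (hinj (by rw [hzero, map_zero]))

/-- **The criterion**: `χ_x` is separable iff `χ_x′(x)` is invertible. [cite: Borel1991, IV.12.3] -/
theorem charpoly_separable_iff_isUnit_aeval_derivative (x : Matrix n n E) :
    x.charpoly.Separable ↔ IsUnit (aeval x (derivative x.charpoly)) :=
  ⟨fun h => isUnit_aeval_derivative_of_separable h (Matrix.aeval_self_charpoly x), charpoly_separable_of_isUnit_aeval_derivative x⟩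

end Algebra

/-! ## §2 Openness of the regular semisimple locus -/

section Topology

variable {E : Type*} [Field E] [TopologicalSpace E] [IsTopologicalRing E] {n : Type*} [Fintype n] [DecidableEq n]

/-- **`x ↦ χ_x′(x)` is continuous** (it is the divided difference `D(χ_x; x, x)`, ★ `dividedDiff_self`, whose ingredients are the continuous
coefficients of `χ_x`, ★ `continuous_charpoly_coeff`, and powers of `x`). [cite: Borel1991, IV.12.2] -/
theorem continuous_aeval_derivative_charpoly : Continuous fun x : Matrix n n E => aeval x (derivative x.charpoly) := by
  haveI : Nontrivial E := inferInstance
  have hN : ∀ x : Matrix n n E, x.charpoly.natDegree < Fintype.card n + 1 := fun x => by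
    rw [Matrix.charpoly_natDegree_eq_dim]
    exact Nat.lt_succ_self _
  have h : ∀ x : Matrix n n E, aeval x (derivative x.charpoly) =
      ∑ k ∈ Finset.range (Fintype.card n + 1), x.charpoly.coeff k • ∑ j ∈ Finset.range k, x ^ j * x ^ (k - 1 - j) := fun x =>
    (dividedDiff_self x.charpoly (hN x) x).symm
  simp_rw [h]
  refine continuous_finsetSum _ fun k _ => ((continuous_charpoly_coeff k).smul ?_)
  exact continuous_finsetSum _ fun j _ => (continuous_id.pow j).mul (continuous_id.pow _)

variable [T1Space E]

/-- **THE REGULAR SEMISIMPLE LOCUS IS OPEN**: `{x : M_n(E) | χ_x separable}` is open (`χ_x′(x)` depends continuously on `x` and being a unit is the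
open condition `det ≠ 0`; ★ `charpoly_separable_iff_isUnit_aeval_derivative`). [cite: Borel1991, IV.12.3] [cite: HarishChandra1970, Part I §3] -/
theorem isOpen_setOf_charpoly_separable : IsOpen {x : Matrix n n E | x.charpoly.Separable} := by
  have h : {x : Matrix n n E | x.charpoly.Separable} = (fun x : Matrix n n E => (aeval x (derivative x.charpoly)).det) ⁻¹' {0}ᶜ := by
    ext x
    rw [Set.mem_setOf_eq, charpoly_separable_iff_isUnit_aeval_derivative, Matrix.isUnit_iff_isUnit_det, isUnit_iff_ne_zero]
    rfl
  rw [h]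
  exact isOpen_compl_singleton.preimage continuous_aeval_derivative_charpoly.matrix_det

/-- `GL_n` form: `{g : GL_n(E) | χ_g separable}` is open. [cite: Borel1991, IV.12.3] -/
theorem isOpen_setOf_charpoly_separable_units : IsOpen {g : GL n E | (g : Matrix n n E).charpoly.Separable} :=
  isOpen_setOf_charpoly_separable.preimage Units.continuous_val

/-- Subgroup form: for `U ≤ GL_n(E)`, `{u : U | χ_u separable}` is open in `U`. [cite: Borel1991, IV.12.3] [cite: Rogawski1990, §3.1 p. 19] -/
theorem _root_.Subgroup.isOpen_setOf_charpoly_separable (U : Subgroup (GL n E)) :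
    IsOpen {u : ↥U | ((u : GL n E) : Matrix n n E).charpoly.Separable} :=
  isOpen_setOf_charpoly_separable_units.preimage continuous_subtype_val

/-- Filter form: near a regular semisimple `γ` every matrix is regular semisimple. [cite: Borel1991, IV.12.3] -/
theorem eventually_charpoly_separable {γ : Matrix n n E} (hγ : γ.charpoly.Separable) :
    ∀ᶠ x in 𝓝 γ, x.charpoly.Separable :=
  isOpen_setOf_charpoly_separable.mem_nhds hγ

end Topology

end Literature.LinearAlgebra.Matrix
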